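import Literature.NumberTheory.EllipticCurves.Kato2004.AdmissibleZetaClass
import Literature.NumberTheory.EllipticCurves.IwasawaAlgebraCharIdealProofs
import HarnessLib

set_option linter.dupNamespace false
set_option autoImplicit false

/-!
# (E2) `stub_muFreeRealisedFamilySeven` — the EXPONENT clause `0 ≤ e`: a realised family that is a `Λˣ`-multiple of
# `M̃ • 𝐳` has `e = 0` (pure `Λ`-algebra; kernel, every prime `p`) — ideator bsd-idea-20 g67, companion of
# `RealisationExponent-g67.md`

Crux `EllipticUnitValueSevenOfGZK` (stmt-BirchSwinnertonDyer-19945), route `RamifiedSevenEllipticUnits`, line of record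
`Lines/kato_perrin_riou_zp.lean` v14 (sha16 6f202717661c60d4; (E2) = `stub_muFreeRealisedFamilySeven`, v11 VERBATIM) —
UNTOUCHED (W-79: publish-only, no `skeleton check`).  HONEST LABEL: nothing here proves (E2), no item is closed, no `_holds`,
no summit statement is proved or advanced; `sorry`-free, no `def` of mathematical content beyond abbreviations, no instance,
no notation.

## What is proved (the algebraic half of the memo's §2)

In `Kato2004.ZetaClassPositionBody` (★, `ZetaClassOnRankLeOneBranch.lean` §2) the position of Kato's `Ω_W`-normalised class
`𝐳` (with `z₁ = p^k • 𝐳`) relative to a realised value-pinned family `y` is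
`((p : Λ)^{(−e)⁺} · M̃) • z₁ = (u · (p : Λ)^{e⁺} · (p : Λ)^k) • y`, `u ∈ Λˣ`, where `e = v_p((Ω⁺_f/Ω_W)/(q·q⁻))` is the
exponent of the family's scalars ((A5′) of `HasRealisedZetaFamilyBody`).  The memo (§2, reading (R•) = Kato Lemma 13.10 (1) +
§13.9 + the readings (m1)–(m3) of `Kato2004/MemberMultiplierInputs.lean` + transport of structure along the lattice
isomorphism `T_pW_K ≅ V_{ℤ_p}(f)(1)` of Kato's member `W_K`) shows that Kato's OWN integral family, transported to
`𝐇¹_Γ(T_pW_K)`, satisfies `y = (w · M̃) • 𝐳` with `w ∈ Λˣ`.  THIS FILE: these two relations force `e = 0` — for any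
domain `R`, prime element `π`, torsion-free `R`-module, and any `M̃` with `M̃ • 𝐳 ≠ 0`:

* `RealisationExponent.eq_zero_of_position_of_generator` — generic: `(π^{(−e)⁺} M̃) • z₁ = (u π^{e⁺} π^k) • y`,
  `z₁ = π^k • 𝐳`, `y = (w M̃) • 𝐳`, `M̃ • 𝐳 ≠ 0` ⟹ `e = 0`;
* `RealisationExponent.nonneg_of_position_of_generator` — the (E2) clause `0 ≤ e` as a corollary;
* `RealisationExponent.eq_zero_of_position_of_generator_iwasawa` — the same over `Λ = IwasawaAlgebra p` with `π = (p : Λ)`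
  (prime: `IwasawaAlgebra.prime_C`) and `M̃ = katoMultiplier p c d₁ n₁ n₂ n₃ n₄ Ψc Ψd E aℓ εℓ Ψℓ` displayed LETTER FOR LETTER as in ★.

So at Kato's member the exponent clause of (E2) carries no content beyond the realisation itself: `e` is not a free
«member-dependent input» there but is PINNED to `0` (memo §2); at a non-member `W″` the same algebra with `y″ = (w · p^t · M̃) • 𝐳″`
(`t ≥ 1`, memo §2.4) gives `e″ = −t < 0` for the naively transported family — the reason (E2) quantifies `∃ W′`.

References: K. Kato, Astérisque 295 (2004), Thm. 12.5 (1) (p. 221), §13.9 and Lemma 13.10 (1) (pp. 229–230), §8.3 (p. 181),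
§5.5 (p. 156) [Kato2004Asterisque]; C. Wuthrich, Doc. Math. 19 (2014), Prop. 8 (p. 388) [Wuthrich2014]; tree:
`Kato2004/ZetaClassOnRankLeOneBranch.lean` (`ZetaClassPositionBody`, `HasMuFreeRealisedZetaFamilyBody`),
`Kato2004/MemberMultiplierInputs.lean` ((m1)–(m4)), `Kato2004/AdmissibleZetaClass.lean` (`katoMultiplier`),
`IwasawaAlgebraCharIdealProofs.lean` (`IwasawaAlgebra.prime_C`).
-/

namespace Summit.BirchSwinnertonDyer.BirchSwinnertonDyer.Cruxes.EllipticUnitValueSevenOfGZK.RealisationExponent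

open Literature.NumberTheory.EllipticCurves Literature.NumberTheory.EllipticCurves.Kato2004

section Generic

variable {R M : Type*} [CommRing R] [IsDomain R] [AddCommGroup M] [Module R M] [NoZeroSMulDivisors R M]

/-- **A unit-multiple-of-`M̃ • 𝐳` family has exponent `0`.**  If `π` is a prime element of a domain `R`, `M` a torsion-free
`R`-module, `M̃ • 𝐳 ≠ 0`, `z₁ = π^k • 𝐳`, and a family `y` satisfies BOTH the ★-position relation
`(π^{(−e)⁺} · M̃) • z₁ = (u · π^{e⁺} · π^k) • y` (`u ∈ Rˣ`) AND `y = (w · M̃) • 𝐳` (`w ∈ Rˣ`), then `e = 0`.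
Kernel (compare scalars on the non-zero vector `M̃ • 𝐳`; a positive power of a prime is not a unit).
[cite: Kato2004Asterisque, Thm. 12.5 (1) (p. 221), Lemma 13.10 (1) (p. 230)] -/
theorem eq_zero_of_position_of_generator {π : R} (hπ : Prime π) {Mt : R} {u w : Rˣ} {e : ℤ} {k : ℕ} {zγ z₁ y : M}
    (hz : Mt • zγ ≠ 0) (hz₁ : z₁ = π ^ k • zγ)
    (hpos : (π ^ (-e).toNat * Mt) • z₁ = ((u : R) * π ^ e.toNat * π ^ k) • y)
    (hgen : y = ((w : R) * Mt) • zγ) : e = 0 := by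
  -- both sides as scalar multiples of the non-zero vector `Mt • zγ`
  have key : (π ^ ((-e).toNat + k)) • (Mt • zγ) = ((u : R) * w * π ^ (e.toNat + k)) • (Mt • zγ) := by
    have h := hpos
    rw [hz₁, hgen, ← mul_smul, ← mul_smul] at h
    rw [← mul_smul, ← mul_smul]
    convert h using 2 <;> ring
  have hscal : π ^ ((-e).toNat + k) = (u : R) * w * π ^ (e.toNat + k) := smul_left_injective R hz key
  -- cancel `π ^ k`
  have hπ0 : π ≠ 0 := hπ.ne_zero
  have hcancel : π ^ (-e).toNat = (u : R) * w * π ^ e.toNat := by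
    have h2 : π ^ (-e).toNat * π ^ k = ((u : R) * w * π ^ e.toNat) * π ^ k := by
      rw [← pow_add, hscal, pow_add]; ring
    exact mul_right_cancel₀ (pow_ne_zero k hπ0) h2
  have huw : IsUnit ((u : R) * w) := (Units.isUnit u).mul (Units.isUnit w)
  rcases lt_trichotomy e 0 with h | h | h
  · -- `e < 0`: `π^{(−e)⁺} = u w` is a unit, but `(−e)⁺ ≠ 0`
    exfalso
    have hb : e.toNat = 0 := Int.toNat_eq_zero.mpr h.le
    have ha : (-e).toNat ≠ 0 := by omega
    rw [hb, pow_zero, mul_one] at hcancel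
    have : IsUnit (π ^ (-e).toNat) := by rw [hcancel]; exact huw
    exact hπ.not_unit ((isUnit_pow_iff ha).mp this)
  · exact h
  · -- `e > 0`: `1 = u w π^{e⁺}` makes `π^{e⁺}` a unit, but `e⁺ ≠ 0`
    exfalso
    have ha : (-e).toNat = 0 := Int.toNat_eq_zero.mpr (by omega)
    have hb : e.toNat ≠ 0 := by omega
    rw [ha, pow_zero] at hcancel
    have : IsUnit (π ^ e.toNat) := isUnit_of_mul_isUnit_right (hcancel ▸ isUnit_one)
    exact hπ.not_unit ((isUnit_pow_iff hb).mp this)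

/-- **Corollary: the (E2) clause `0 ≤ e`** for such a family. Kernel. [cite: Kato2004Asterisque, Lemma 13.10 (1) (p. 230)] -/
theorem nonneg_of_position_of_generator {π : R} (hπ : Prime π) {Mt : R} {u w : Rˣ} {e : ℤ} {k : ℕ} {zγ z₁ y : M}
    (hz : Mt • zγ ≠ 0) (hz₁ : z₁ = π ^ k • zγ)
    (hpos : (π ^ (-e).toNat * Mt) • z₁ = ((u : R) * π ^ e.toNat * π ^ k) • y)
    (hgen : y = ((w : R) * Mt) • zγ) : 0 ≤ e :=
  (eq_zero_of_position_of_generator hπ hz hz₁ hpos hgen).symm.le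

/-- **The non-member shift** (memo §2.4): if instead `y = (w · π^t · M̃) • 𝐳` with `t : ℕ` (the naively transported family at a
lattice `p^t`-below Kato's), the same comparison gives `e = −t`.  Kernel. [cite: Kato2004Asterisque, Lemma 13.10 (1) (p. 230)] -/
theorem eq_neg_of_position_of_pow_generator {π : R} (hπ : Prime π) {Mt : R} {u w : Rˣ} {e : ℤ} {k t : ℕ}
    {zγ z₁ y : M} (hz : Mt • zγ ≠ 0) (hz₁ : z₁ = π ^ k • zγ)
    (hpos : (π ^ (-e).toNat * Mt) • z₁ = ((u : R) * π ^ e.toNat * π ^ k) • y)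
    (hgen : y = ((w : R) * π ^ t * Mt) • zγ) : e = -(t : ℤ) := by
  have key : (π ^ ((-e).toNat + k)) • (Mt • zγ) = ((u : R) * w * π ^ (e.toNat + t + k)) • (Mt • zγ) := by
    have h := hpos
    rw [hz₁, hgen, ← mul_smul, ← mul_smul] at h
    rw [← mul_smul, ← mul_smul]
    convert h using 2 <;> ring
  have hscal : π ^ ((-e).toNat + k) = (u : R) * w * π ^ (e.toNat + t + k) := smul_left_injective R hz key
  have hπ0 : π ≠ 0 := hπ.ne_zero
  have hcancel : π ^ (-e).toNat = (u : R) * w * π ^ (e.toNat + t) := by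
    have h2 : π ^ (-e).toNat * π ^ k = ((u : R) * w * π ^ (e.toNat + t)) * π ^ k := by
      rw [← pow_add, hscal, pow_add]; ring
    exact mul_right_cancel₀ (pow_ne_zero k hπ0) h2
  have huw : IsUnit ((u : R) * w) := (Units.isUnit u).mul (Units.isUnit w)
  -- compare exponents: `(−e)⁺ = e⁺ + t`
  -- case split on the sign of `e`
  rcases le_or_gt e 0 with h | h
  · have hb : e.toNat = 0 := Int.toNat_eq_zero.mpr h
    rw [hb, zero_add] at hcancel
    -- `π^{(−e)⁺} = u w π^t` ⇒ `(−e)⁺ = t` by unique factorisation of powers of a prime up to units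
    have hdvd1 : π ^ t ∣ π ^ (-e).toNat := ⟨(u : R) * w, by rw [hcancel]; ring⟩
    have hdvd2 : π ^ (-e).toNat ∣ π ^ t := by
      refine ⟨((huw.unit⁻¹ : Rˣ) : R), ?_⟩
      rw [hcancel, mul_comm ((u : R) * w) (π ^ t), mul_assoc, IsUnit.mul_val_inv, mul_one]
    have h1 : t ≤ (-e).toNat := (pow_dvd_pow_iff hπ0 hπ.not_unit).mp hdvd1
    have h2 : (-e).toNat ≤ t := (pow_dvd_pow_iff hπ0 hπ.not_unit).mp hdvd2
    omega
  · exfalso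
    have ha : (-e).toNat = 0 := Int.toNat_eq_zero.mpr (by omega)
    have hb : e.toNat + t ≠ 0 := by omega
    rw [ha, pow_zero] at hcancel
    have : IsUnit (π ^ (e.toNat + t)) := isUnit_of_mul_isUnit_right (hcancel ▸ isUnit_one)
    exact hπ.not_unit ((isUnit_pow_iff hb).mp this)

end Generic

section Iwasawa

variable (p : ℕ) [Fact p.Prime]

/-- `(p : Λ)` is a prime element of `Λ = ℤ_p⟦T⟧` (the tree's `IwasawaAlgebra.prime_C`, transported along `C p = p`).
[cite: Washington1997, §13.1] -/
theorem prime_natCast_iwasawa : Prime ((p : ℕ) : IwasawaAlgebra p) := by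
  have h := IwasawaAlgebra.prime_C p
  rwa [map_natCast] at h

variable {p}
variable {H : Type*} [AddCommGroup H] [Module (IwasawaAlgebra p) H] [NoZeroSMulDivisors (IwasawaAlgebra p) H]

/-- **(E2)'s exponent at Kato's member is `0`** — the ★-position relation of `Kato2004.ZetaClassPositionBody` (conclusion,
letter for letter: `((p:Λ)^{(−e)⁺} · M̃) • z₁ = (u · (p:Λ)^{e⁺} · (p:Λ)^k) • y` with
`M̃ = katoMultiplier p c d₁ n₁ n₂ n₃ n₄ Ψc Ψd E aℓ εℓ Ψℓ`) together with the member relation `y = (w · M̃) • 𝐳` (Kato's own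
integral family transported along `T_pW_K ≅ V_{ℤ_p}(f)(1)`: Lemma 13.10 (1) + §13.9 + (m1)–(m3) of
`MemberMultiplierInputs.lean`, memo §2) force `e = 0`, in any torsion-free `Λ`-module (e.g. `I.H` of a pinned
`IwasawaH1Data` at a top generator, `I.isTorsionFree hγ`).  Kernel; nothing about (E2) itself is asserted.
[cite: Kato2004Asterisque, Thm. 12.5 (1) (p. 221), §13.9 and Lemma 13.10 (1) (pp. 229–230), §8.3 (p. 181)] -/
theorem eq_zero_of_position_of_generator_iwasawa (c d₁ n₁ n₂ n₃ n₄ : ℤ) (Ψc Ψd : IwasawaAlgebra p) (E : Finset ℕ)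
    (aℓ εℓ : ℕ → ℤ) (Ψℓ : ℕ → IwasawaAlgebra p) {u w : (IwasawaAlgebra p)ˣ} {e : ℤ} {k : ℕ} {zγ z₁ y : H}
    (hz : katoMultiplier p c d₁ n₁ n₂ n₃ n₄ Ψc Ψd E aℓ εℓ Ψℓ • zγ ≠ 0)
    (hz₁ : z₁ = ((p : IwasawaAlgebra p) ^ k) • zγ)
    (hpos : (((p : IwasawaAlgebra p) ^ (-e).toNat * katoMultiplier p c d₁ n₁ n₂ n₃ n₄ Ψc Ψd E aℓ εℓ Ψℓ)) • z₁ =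
      (((u : IwasawaAlgebra p) * (p : IwasawaAlgebra p) ^ e.toNat * (p : IwasawaAlgebra p) ^ k)) • y)
    (hgen : y = (((w : IwasawaAlgebra p) * katoMultiplier p c d₁ n₁ n₂ n₃ n₄ Ψc Ψd E aℓ εℓ Ψℓ)) • zγ) :
    e = 0 :=
  eq_zero_of_position_of_generator (prime_natCast_iwasawa p) hz hz₁ hpos hgen

/-- The (E2) clause `0 ≤ e` at Kato's member, same hypotheses. Kernel. [cite: Kato2004Asterisque, Lemma 13.10 (1) (p. 230)] -/
theorem nonneg_of_position_of_generator_iwasawa (c d₁ n₁ n₂ n₃ n₄ : ℤ) (Ψc Ψd : IwasawaAlgebra p) (E : Finset ℕ)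
    (aℓ εℓ : ℕ → ℤ) (Ψℓ : ℕ → IwasawaAlgebra p) {u w : (IwasawaAlgebra p)ˣ} {e : ℤ} {k : ℕ} {zγ z₁ y : H}
    (hz : katoMultiplier p c d₁ n₁ n₂ n₃ n₄ Ψc Ψd E aℓ εℓ Ψℓ • zγ ≠ 0)
    (hz₁ : z₁ = ((p : IwasawaAlgebra p) ^ k) • zγ)
    (hpos : (((p : IwasawaAlgebra p) ^ (-e).toNat * katoMultiplier p c d₁ n₁ n₂ n₃ n₄ Ψc Ψd E aℓ εℓ Ψℓ)) • z₁ =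
      (((u : IwasawaAlgebra p) * (p : IwasawaAlgebra p) ^ e.toNat * (p : IwasawaAlgebra p) ^ k)) • y)
    (hgen : y = (((w : IwasawaAlgebra p) * katoMultiplier p c d₁ n₁ n₂ n₃ n₄ Ψc Ψd E aℓ εℓ Ψℓ)) • zγ) :
    0 ≤ e :=
  (eq_zero_of_position_of_generator_iwasawa c d₁ n₁ n₂ n₃ n₄ Ψc Ψd E aℓ εℓ Ψℓ hz hz₁ hpos hgen).symm.le

/-- **The non-member shift over `Λ`**: with `y = (w · p^t · M̃) • 𝐳` the exponent is `e = −t`. Kernel.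
[cite: Kato2004Asterisque, Lemma 13.10 (1) (p. 230)] -/
theorem eq_neg_of_position_of_pow_generator_iwasawa (c d₁ n₁ n₂ n₃ n₄ : ℤ) (Ψc Ψd : IwasawaAlgebra p)
    (E : Finset ℕ) (aℓ εℓ : ℕ → ℤ) (Ψℓ : ℕ → IwasawaAlgebra p) {u w : (IwasawaAlgebra p)ˣ} {e : ℤ} {k t : ℕ}
    {zγ z₁ y : H}
    (hz : katoMultiplier p c d₁ n₁ n₂ n₃ n₄ Ψc Ψd E aℓ εℓ Ψℓ • zγ ≠ 0)
    (hz₁ : z₁ = ((p : IwasawaAlgebra p) ^ k) • zγ)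
    (hpos : (((p : IwasawaAlgebra p) ^ (-e).toNat * katoMultiplier p c d₁ n₁ n₂ n₃ n₄ Ψc Ψd E aℓ εℓ Ψℓ)) • z₁ =
      (((u : IwasawaAlgebra p) * (p : IwasawaAlgebra p) ^ e.toNat * (p : IwasawaAlgebra p) ^ k)) • y)
    (hgen : y = (((w : IwasawaAlgebra p) * (p : IwasawaAlgebra p) ^ t *
      katoMultiplier p c d₁ n₁ n₂ n₃ n₄ Ψc Ψd E aℓ εℓ Ψℓ)) • zγ) :
    e = -(t : ℤ) :=
  eq_neg_of_position_of_pow_generator (prime_natCast_iwasawa p) hz hz₁ hpos hgen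

end Iwasawa

end Summit.BirchSwinnertonDyer.BirchSwinnertonDyer.Cruxes.EllipticUnitValueSevenOfGZK.RealisationExponent
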